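import Summits.CriticalPhenomena.PercolationContinuityZ3.Theorems.SahiMasterFamilyFInequalityGoodCoordinate
import Summits.CriticalPhenomena.PercolationContinuityZ3.Theorems.SahiMasterFamilyFInequalityFirstArgument

/-!
# The `F`-inequality: BOUNDED CONVEXITY — `∂²F/∂p_e² ≤ ½·I_e(G)²` along every coordinate, and the bound is sharp

Unit `prim-master-conj` (crux anchor stmt-CriticalPhenomena-4575, helper work), gen 22; memo
`run/shared/lean/prim/prim-l12/prim-master-conj/POINTWISE.md` §23.A′ and `GOOD-COORDINATE.md`.  Companion of `…FInequalityGoodCoordinate`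
(exact chord form `F = (1−t)F⁰ + tF¹ + t(1−t)·D_e`, `D_e = Δa·Δb + Δg·Δm = −½∂²F/∂p_e²`).

* `dLoc_ge_neg_quarter_sq` — for increasing `A, B, G` and every coordinate `e`:  **`D_e ≥ −(μG¹ − μG⁰)²/4 = −I_e(G)²/4`**.  Proof: with
  `c := μ(A⁰B⁰G¹) − μ(A⁰B⁰G⁰)` (the `A∩B`-interior mass on the `e`-annulus of `G` — the only negative ingredient of `D_e`) one has `Δa ≥ c`, `Δb ≥ c`,
  `Δm ≥ −c`, `Δg ≥ 0`, hence `D_e ≥ c² − Δg·c ≥ −Δg²/4`.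
* `fIneq_ge_chord_sub_quarter_sq` — consequently **`F ≥ (1−p_e)·F(A⁰,B⁰;G⁰) + p_e·F(A¹,B¹;G¹) − p_e(1−p_e)·I_e(G)²/4`**: `F` is never more convex along `e`
  than `I_e(G)²/2`; the induction step `X_e ≥ 0` holds at `e` as soon as `F⁰ + F¹ ≥ I_e(G)²/4`.
SHARPNESS (paper, memo §23.A′): for `A = B = Tribes(w,m)`, `G =` majority of the same `n = wm` coordinates, `p ≡ ½`, one has `D_e/I_e(G)² → −¼` (`−0.108` at
`n = 2709`, `−0.172` at `n = 15411`; exact DP) — the family that refutes the good-coordinate conjecture is extremal for this bound.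
HONEST FRAMING: elementary; `F ≥ 0` remains OPEN. [this work]
-/

noncomputable section

open scoped Classical

namespace Summit.CriticalPhenomena.PercolationContinuityZ3.Theorems

open Finset Function
open Literature.Combinatorics.Sahi2008
open Literature.Probability.Percolation.DecisionTree (ind)

namespace Pointwise

variable {ι : Type} [Fintype ι]

local notation3 (prettyPrint := false) "μ⟦" p ", " X "⟧" => ex (bernoulliWeight p) (ind X)

/-- Measure differences along a nested pair are monotone in an intersected set: if `Y ⊆ Y'` and `X ⊆ X'`... here the special form we need:
for `G⁰ ⊆ G¹` and `X ⊆ X'`, `μ(X∩G¹) − μ(X∩G⁰) ≤ μ(X'∩G¹) − μ(X'∩G⁰)` (both sides are measures of `· ∩ (G¹ ∖ G⁰)`). [folklore] -/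
theorem ex_ind_annulus_mono (p : ι → unitInterval) {X X' G0 G1 : Set (Set ι)} (hX : X ⊆ X') (hG : G0 ⊆ G1) :
    μ⟦p, X ∩ G1⟧ - μ⟦p, X ∩ G0⟧ ≤ μ⟦p, X' ∩ G1⟧ - μ⟦p, X' ∩ G0⟧ := by
  rw [ex_ind_sub_of_subset (bernoulliWeight p) (Set.inter_subset_inter_right X hG),
    ex_ind_sub_of_subset (bernoulliWeight p) (Set.inter_subset_inter_right X' hG)]
  have hsub : (X ∩ G1) \ (X ∩ G0) ⊆ (X' ∩ G1) \ (X' ∩ G0) := by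
    rintro ω ⟨⟨hωX, hωG1⟩, hω0⟩
    exact ⟨⟨hX hωX, hωG1⟩, fun h => hω0 ⟨hωX, h.2⟩⟩
  have h1 := ex_ind_sub_of_subset (bernoulliWeight p) hsub
  have h2 := ex_ind_nonneg' p (((X' ∩ G1) \ (X' ∩ G0)) \ ((X ∩ G1) \ (X ∩ G0)))
  linarith

/-- **BOUNDED CONVEXITY: `D_e ≥ −I_e(G)²/4`** for increasing `A, B, G` (`D_e = Δa·Δb + Δg·Δm`, `I_e(G) = μG¹ − μG⁰`). [this work] -/
theorem dLoc_ge_neg_quarter_sq (p : ι → unitInterval) (e : ι) {A B G : Set (Set ι)} (hA : IsUpperSet A) (hB : IsUpperSet B)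
    (hG : IsUpperSet G) :
    -((μ⟦p, secAt e true G⟧ - μ⟦p, secAt e false G⟧) ^ 2) / 4
      ≤ (μ⟦p, secAt e true A ∩ secAt e true G⟧ - μ⟦p, secAt e false A ∩ secAt e false G⟧)
            * (μ⟦p, secAt e true B ∩ secAt e true G⟧ - μ⟦p, secAt e false B ∩ secAt e false G⟧)
          + (μ⟦p, secAt e true G⟧ - μ⟦p, secAt e false G⟧)
            * ((μ⟦p, secAt e true A ∩ secAt e true B⟧ - μ⟦p, secAt e true A ∩ secAt e true B ∩ secAt e true G⟧)
              - (μ⟦p, secAt e false A ∩ secAt e false B⟧ - μ⟦p, secAt e false A ∩ secAt e false B ∩ secAt e false G⟧)) := by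
  set A0 := secAt e false A; set A1 := secAt e true A
  set B0 := secAt e false B; set B1 := secAt e true B
  set G0 := secAt e false G; set G1 := secAt e true G
  have sA : A0 ⊆ A1 := RigidityAll.secAt_false_subset_secAt_true e hA
  have sB : B0 ⊆ B1 := RigidityAll.secAt_false_subset_secAt_true e hB
  have sG : G0 ⊆ G1 := RigidityAll.secAt_false_subset_secAt_true e hG
  -- the enemy mass `c = μ(A⁰B⁰G¹) − μ(A⁰B⁰G⁰)`
  set c := μ⟦p, A0 ∩ B0 ∩ G1⟧ - μ⟦p, A0 ∩ B0 ∩ G0⟧ with hc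
  -- Δa ≥ μ(A⁰G¹) − μ(A⁰G⁰) ≥ c
  have hΔa : c ≤ μ⟦p, A1 ∩ G1⟧ - μ⟦p, A0 ∩ G0⟧ := by
    have h1 : c ≤ μ⟦p, A0 ∩ G1⟧ - μ⟦p, A0 ∩ G0⟧ := ex_ind_annulus_mono p Set.inter_subset_left sG
    have h2 : μ⟦p, A0 ∩ G1⟧ ≤ μ⟦p, A1 ∩ G1⟧ := ex_ind_le_of_subset p (Set.inter_subset_inter_left _ sA)
    linarith
  have hΔb : c ≤ μ⟦p, B1 ∩ G1⟧ - μ⟦p, B0 ∩ G0⟧ := by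
    have h1 : c ≤ μ⟦p, B0 ∩ G1⟧ - μ⟦p, B0 ∩ G0⟧ := by
      have := ex_ind_annulus_mono p (Set.inter_subset_right : A0 ∩ B0 ⊆ B0) sG
      linarith
    have h2 : μ⟦p, B0 ∩ G1⟧ ≤ μ⟦p, B1 ∩ G1⟧ := ex_ind_le_of_subset p (Set.inter_subset_inter_left _ sB)
    linarith
  -- Δm ≥ −c:  [μ(A¹B¹) − μ(A¹B¹G¹)] − [μ(A⁰B⁰) − μ(A⁰B⁰G⁰)] ≥ −[μ(A⁰B⁰G¹) − μ(A⁰B⁰G⁰)]  ⟸  μ(A¹B¹ ∖ G¹) ≥ μ(A⁰B⁰ ∖ G¹)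
  have hΔm : -c ≤ (μ⟦p, A1 ∩ B1⟧ - μ⟦p, A1 ∩ B1 ∩ G1⟧) - (μ⟦p, A0 ∩ B0⟧ - μ⟦p, A0 ∩ B0 ∩ G0⟧) := by
    have e1 := ex_ind_sub_of_subset (bernoulliWeight p) (Set.inter_subset_left : A1 ∩ B1 ∩ G1 ⊆ A1 ∩ B1)
    have e0 := ex_ind_sub_of_subset (bernoulliWeight p) (Set.inter_subset_left : A0 ∩ B0 ∩ G1 ⊆ A0 ∩ B0)
    have hmono : μ⟦p, (A0 ∩ B0) \ (A0 ∩ B0 ∩ G1)⟧ ≤ μ⟦p, (A1 ∩ B1) \ (A1 ∩ B1 ∩ G1)⟧ := by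
      refine ex_ind_le_of_subset p ?_
      rintro ω ⟨⟨hωA, hωB⟩, hωG⟩
      exact ⟨⟨sA hωA, sB hωB⟩, fun h => hωG ⟨⟨hωA, hωB⟩, h.2⟩⟩
    linarith
  have hΔg : 0 ≤ μ⟦p, G1⟧ - μ⟦p, G0⟧ := sub_nonneg.2 (ex_ind_le_of_subset p sG)
  have hc0 : 0 ≤ c := by
    have := ex_ind_le_of_subset p (Set.inter_subset_inter_right (A0 ∩ B0) sG)
    linarith
  -- D ≥ c·c − Δg·c ≥ −Δg²/4
  have step1 : c * c ≤ (μ⟦p, A1 ∩ G1⟧ - μ⟦p, A0 ∩ G0⟧) * (μ⟦p, B1 ∩ G1⟧ - μ⟦p, B0 ∩ G0⟧) :=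
    mul_le_mul hΔa hΔb hc0 (le_trans hc0 hΔa)
  have step2 : (μ⟦p, G1⟧ - μ⟦p, G0⟧) * (-c)
      ≤ (μ⟦p, G1⟧ - μ⟦p, G0⟧) * ((μ⟦p, A1 ∩ B1⟧ - μ⟦p, A1 ∩ B1 ∩ G1⟧) - (μ⟦p, A0 ∩ B0⟧ - μ⟦p, A0 ∩ B0 ∩ G0⟧)) :=
    mul_le_mul_of_nonneg_left hΔm hΔg
  nlinarith [sq_nonneg (c - (μ⟦p, G1⟧ - μ⟦p, G0⟧) / 2), step1, step2]

/-- **`F ≥ (1−p_e)·F⁰ + p_e·F¹ − p_e(1−p_e)·I_e(G)²/4`**: the chord form with the bounded-convexity estimate. [this work] -/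
theorem fIneq_ge_chord_sub_quarter_sq (p : ι → unitInterval) (e : ι) {A B G : Set (Set ι)} (hA : IsUpperSet A) (hB : IsUpperSet B)
    (hG : IsUpperSet G) :
    (1 - (p e : ℝ)) * ((1 + μ⟦p, secAt e false G⟧) * μ⟦p, secAt e false A ∩ secAt e false B ∩ secAt e false G⟧
          - μ⟦p, secAt e false G⟧ * μ⟦p, secAt e false A ∩ secAt e false B⟧
          - μ⟦p, secAt e false A ∩ secAt e false G⟧ * μ⟦p, secAt e false B ∩ secAt e false G⟧)
        + (p e : ℝ) * ((1 + μ⟦p, secAt e true G⟧) * μ⟦p, secAt e true A ∩ secAt e true B ∩ secAt e true G⟧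
          - μ⟦p, secAt e true G⟧ * μ⟦p, secAt e true A ∩ secAt e true B⟧
          - μ⟦p, secAt e true A ∩ secAt e true G⟧ * μ⟦p, secAt e true B ∩ secAt e true G⟧)
        - (p e : ℝ) * (1 - (p e : ℝ)) * ((μ⟦p, secAt e true G⟧ - μ⟦p, secAt e false G⟧) ^ 2 / 4)
      ≤ (1 + μ⟦p, G⟧) * μ⟦p, A ∩ B ∩ G⟧ - μ⟦p, G⟧ * μ⟦p, A ∩ B⟧ - μ⟦p, A ∩ G⟧ * μ⟦p, B ∩ G⟧ := by
  rw [fIneq_eq_chord_add_dLoc p e A B G]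
  have hD := dLoc_ge_neg_quarter_sq p e hA hB hG
  have ht0 : 0 ≤ (p e : ℝ) := (p e).2.1
  have ht1 : 0 ≤ 1 - (p e : ℝ) := sub_nonneg.2 (p e).2.2
  nlinarith [mul_le_mul_of_nonneg_left hD (mul_nonneg ht0 ht1)]

end Pointwise

end Summit.CriticalPhenomena.PercolationContinuityZ3.Theorems
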